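import Literature.RingTheory.Flat.GenericFreeness
import Mathlib.LinearAlgebra.FreeModule.Basic
import Mathlib.Algebra.Module.Projective
import Mathlib.LinearAlgebra.LinearIndependent.Lemmas
import Mathlib.Algebra.Module.LocalizedModule.Submodule
import Mathlib.RingTheory.Spectrum.Prime.FreeLocus
import Mathlib.RingTheory.Noetherian.Basic
import Mathlib.RingTheory.Finiteness.Basic
import Mathlib.RingTheory.Localization.BaseChange
import Mathlib.RingTheory.Localization.Away.Basic
import Mathlib.RingTheory.Localization.Free
import Mathlib.RingTheory.Localization.Module
import Mathlib.LinearAlgebra.TensorProduct.Tower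
import Mathlib.RingTheory.Finiteness.Subalgebra
import Mathlib.RingTheory.Localization.FractionRing
import HarnessLib

/-!
# Generic freeness (Görtz–Wedhorn I, Thm. 10.83) — proof

Discharge of the named fact `Literature.RingTheory.Flat.GortzWedhorn2020_10_83` (generic freeness:
`R` a Noetherian domain, `A` a finitely generated `R`-algebra, `M` a finite `A`-module ⇒ `M_s` is
free over `R_s` for some `s ≠ 0`), following the printed proof (U. Görtz, T. Wedhorn, *Algebraic
Geometry I*, 2nd ed., Lemma 10.81, Lemma 10.82, Thm. 10.83, pp. 318–319): induction on the number
of algebra generators; the monogenic dévissage Lemma 10.82; splitting of filtrations with free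
subquotients over a localization.

## Main results

* `Module.free_of_filtration`: a module with an exhaustive increasing `ℕ`-filtration whose
  subquotients are free is free.
* `GortzWedhorn2020_10_83_holds`.

## References

* [U. Görtz, T. Wedhorn, *Algebraic Geometry I: Schemes*, 2nd ed., (10.22)][GortzWedhorn2020]
-/

open Submodule

namespace Literature.RingTheory.Flat

/-! ### Splitting of exhaustive filtrations with free subquotients -/

section Filtration

variable {R M : Type*} [CommRing R] [AddCommGroup M] [Module R M]

/-- **A module with an exhaustive increasing `ℕ`-filtration `0 = G₀ ⊆ G₁ ⊆ ⋯` whose subquotients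
`G_{k+1}/G_k` are free is free** (the subquotients are projective, so each step splits, and bases
of the `G_k` can be chosen nested; their union is a basis). This is the form of
[GortzWedhorn2020, Prop. B.15] used in the proof of Thm. 10.83. [folklore] -/
theorem _root_.Module.free_of_filtration (G : ℕ → Submodule R M) (hG : Monotone G) (h0 : G 0 = ⊥)
    (hex : ∀ m, ∃ k, m ∈ G k)
    (hfree : ∀ k, Module.Free R (↥(G (k + 1)) ⧸ (G k).submoduleOf (G (k + 1)))) :
    Module.Free R M := by
  classical
  -- sections of the subquotient maps and bases of the subquotients
  have hsec : ∀ k, ∃ σ : (↥(G (k + 1)) ⧸ (G k).submoduleOf (G (k + 1))) →ₗ[R] ↥(G (k + 1)),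
      ((G k).submoduleOf (G (k + 1))).mkQ ∘ₗ σ = LinearMap.id := fun k =>
    Module.projective_lifting_property _ _ (Submodule.mkQ_surjective _)
  choose σ hσ using hsec
  have hσ' : ∀ k q, ((G k).submoduleOf (G (k + 1))).mkQ (σ k q) = q := fun k q =>
    LinearMap.congr_fun (hσ k) q
  let w : ∀ k, Module.Free.ChooseBasisIndex R (↥(G (k + 1)) ⧸ (G k).submoduleOf (G (k + 1))) → M :=
    fun k b => ((G (k + 1)).subtype (σ k (Module.Free.chooseBasis R _ b)))
  let C : ℕ → Set M := fun k => Set.range (w k)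
  -- the pieces `S_k = span C_k`
  have hCle : ∀ k, span R (C k) ≤ G (k + 1) := fun k => by
    rw [span_le]
    rintro _ ⟨b, rfl⟩
    exact (σ k _).2
  have hCspan : ∀ k, span R (C k) = LinearMap.range ((G (k + 1)).subtype ∘ₗ σ k) := fun k => by
    change span R (Set.range (((G (k + 1)).subtype ∘ₗ σ k) ∘ (Module.Free.chooseBasis R _))) = _
    rw [Set.range_comp, Submodule.span_image, Module.Basis.span_eq, Submodule.map_top]
  have hCli : ∀ k, LinearIndepOn R id (C k) := fun k => by
    have hinj : LinearMap.ker ((G (k + 1)).subtype ∘ₗ σ k) = ⊥ := by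
      rw [LinearMap.ker_eq_bot]
      intro q₁ q₂ h
      have h' : σ k q₁ = σ k q₂ := (G (k + 1)).injective_subtype h
      rw [← hσ' k q₁, ← hσ' k q₂, h']
    exact ((Module.Free.chooseBasis R _).linearIndependent.map' _ hinj).linearIndepOn_id
  have hdisj : ∀ k, Disjoint (G k) (span R (C k)) := fun k => by
    rw [hCspan, Submodule.disjoint_def]
    rintro x hx ⟨q, rfl⟩
    have hq : ((G k).submoduleOf (G (k + 1))).mkQ (σ k q) = 0 := by
      rw [Submodule.mkQ_apply, Submodule.Quotient.mk_eq_zero]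
      exact hx
    rw [hσ'] at hq
    rw [hq, map_zero]
  have hsup : ∀ k, G (k + 1) = G k ⊔ span R (C k) := fun k => by
    apply le_antisymm
    · intro m hm
      let q := ((G k).submoduleOf (G (k + 1))).mkQ ⟨m, hm⟩
      have h1 : (m - ((σ k q : ↥(G (k + 1))) : M)) ∈ G k := by
        have : (⟨m, hm⟩ - σ k q : ↥(G (k + 1))) ∈ (G k).submoduleOf (G (k + 1)) := by
          rw [← Submodule.Quotient.mk_eq_zero, ← Submodule.mkQ_apply, map_sub, hσ', sub_self]
        exact this
      have h2 : ((σ k q : ↥(G (k + 1))) : M) ∈ span R (C k) := by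
        rw [hCspan]; exact ⟨q, rfl⟩
      rw [show m = (m - ((σ k q : ↥(G (k + 1))) : M)) + ((σ k q : ↥(G (k + 1))) : M) by abel]
      exact Submodule.add_mem_sup h1 h2
    · exact sup_le (hG (Nat.le_succ k)) (hCle k)
  -- nested bases `B_k = ⋃_{i<k} C_i` of the `G_k`
  let B : ℕ → Set M := fun k => ⋃ i ∈ Finset.range k, C i
  have hBsucc : ∀ k, B (k + 1) = B k ∪ C k := fun k => by
    change ⋃ i ∈ Finset.range (k + 1), C i = (⋃ i ∈ Finset.range k, C i) ∪ C k
    rw [Finset.range_add_one, Finset.set_biUnion_insert, Set.union_comm]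
  have hB : ∀ k, LinearIndepOn R id (B k) ∧ span R (B k) = G k := by
    intro k
    induction k with
    | zero =>
      have hB0 : B 0 = ∅ := by simp [B]
      rw [hB0, h0]
      exact ⟨linearIndepOn_empty R id, Submodule.span_empty⟩
    | succ k ih =>
      rw [hBsucc]
      refine ⟨ih.1.id_union (hCli k) ?_, ?_⟩
      · rw [ih.2]; exact hdisj k
      · rw [Submodule.span_union, ih.2, ← hsup]
  have hBmono : Monotone B := fun k l hkl => by
    intro x hx
    simp only [B, Set.mem_iUnion, Finset.mem_range] at hx ⊢
    obtain ⟨i, hi, hx⟩ := hx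
    exact ⟨i, lt_of_lt_of_le hi hkl, hx⟩
  -- the union is a basis
  have hli : LinearIndepOn R id (⋃ k, B k) :=
    linearIndepOn_iUnion_of_directed hBmono.directed_le fun k => (hB k).1
  have hsp : span R (⋃ k, B k) = ⊤ := by
    rw [Submodule.span_iUnion, eq_top_iff]
    intro m _
    obtain ⟨k, hk⟩ := hex m
    rw [← (hB k).2] at hk
    exact Submodule.mem_iSup_of_mem k hk
  have hsp' : ⊤ ≤ span R (Set.range (Subtype.val : (⋃ k, B k) → M)) := by
    rw [Subtype.range_coe_subtype, Set.setOf_mem_eq, hsp]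
  exact Module.Free.of_basis (Module.Basis.mk hli.linearIndependent hsp')

end Filtration

/-! ### The monogenic dévissage (GW Lemma 10.82) -/

section Devissage

variable {B : Type*} [CommRing B] {A : Type*} [CommRing A] [Algebra B A]
  {M : Type*} [AddCommGroup M] [Module A M] [Module B M] [IsScalarTower B A M]
  (x : A) (N : Submodule B M)

/-- Multiplication by `x` as a `B`-linear map. [folklore] -/
noncomputable def mulX : M →ₗ[B] M := (LinearMap.lsmul A M x).restrictScalars B

/-- `mulX x m = x m`. [folklore] -/
@[simp] theorem mulX_apply (m : M) : mulX (B := B) x m = x • m := rfl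

/-- `mulXⁿ m = xⁿ m`. [folklore] -/
theorem mulX_pow_apply (n : ℕ) (m : M) : (mulX (B := B) x ^ n) m = x ^ n • m := by
  induction n generalizing m with
  | zero => simp
  | succ n ih => rw [pow_succ, Module.End.mul_apply, mulX_apply, ih, smul_smul, ← pow_succ]

/-- **The filtration `F_i = Σ_{j ≤ i} xʲN`** of GW Lemma 10.82 (as `B`-submodules of `M`).
[cite: GortzWedhorn2020, Lemma 10.82 (10.22.1)] -/
noncomputable def devF : ℕ → Submodule B M
  | 0 => N
  | i + 1 => devF i ⊔ N.map (mulX x ^ (i + 1))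

/-- `F₀ = N`. [folklore] -/
theorem devF_zero : devF x N 0 = N := rfl

/-- `F_{i+1} = F_i + x^{i+1}N`. [folklore] -/
theorem devF_succ (i : ℕ) : devF x N (i + 1) = devF x N i ⊔ N.map (mulX x ^ (i + 1)) := rfl

/-- The `F_i` increase. [folklore] -/
theorem devF_monotone : Monotone (devF x N) :=
  monotone_nat_of_le_succ fun i => by rw [devF_succ]; exact le_sup_left

/-- `N ⊆ F_i`. [folklore] -/
theorem le_devF (i : ℕ) : N ≤ devF x N i := devF_monotone x N (Nat.zero_le i)

/-- `xⁱN ⊆ F_i`. [folklore] -/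
theorem map_pow_le_devF (i : ℕ) : N.map (mulX x ^ i) ≤ devF x N i := by
  cases i with
  | zero => rw [pow_zero, Module.End.one_eq_id, Submodule.map_id]; exact le_rfl
  | succ i => rw [devF_succ]; exact le_sup_right

/-- `x F_i ⊆ F_{i+1}`. [folklore] -/
theorem map_mulX_devF_le (i : ℕ) : (devF x N i).map (mulX x) ≤ devF x N (i + 1) := by
  induction i with
  | zero => rw [devF_succ, devF_zero, pow_one]; exact le_sup_right
  | succ i ih =>
    rw [devF_succ x N i, Submodule.map_sup, devF_succ x N (i + 1)]
    refine sup_le (le_trans ih le_sup_left) ?_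
    rw [← Submodule.map_comp]
    change N.map (mulX x * mulX x ^ (i + 1)) ≤ _
    rw [← pow_succ']
    exact le_sup_right

/-- `x F_i ⊆ F_{i+1}`, elementwise. [folklore] -/
theorem mulX_mem_devF {i : ℕ} {m : M} (hm : m ∈ devF x N i) : x • m ∈ devF x N (i + 1) :=
  map_mulX_devF_le x N i ⟨m, hm, rfl⟩

/-- **The filtration is exhaustive** when `A = B[x]` and `AN = M`. [cite: GortzWedhorn2020,
Lemma 10.82] -/
theorem exists_mem_devF (hx : Algebra.adjoin B {x} = ⊤) (hN : span A (N : Set M) = ⊤) (m : M) :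
    ∃ i, m ∈ devF x N i := by
  let T : Submodule B M := ⨆ i, devF x N i
  have hT : ∀ {m}, m ∈ T ↔ ∃ i, m ∈ devF x N i := fun {m} =>
    Submodule.mem_iSup_of_directed _ (devF_monotone x N).directed_le
  -- `T` is stable under `A`
  have hstab : ∀ (a : A), ∀ m ∈ T, a • m ∈ T := by
    intro a
    have ha : a ∈ Algebra.adjoin B {x} := hx ▸ Algebra.mem_top
    refine Algebra.adjoin_induction (p := fun a _ => ∀ m ∈ T, a • m ∈ T) ?_ ?_ ?_ ?_ ha
    · intro y hy m hm
      rw [Set.mem_singleton_iff.mp hy]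
      obtain ⟨i, hi⟩ := hT.mp hm
      exact hT.mpr ⟨i + 1, mulX_mem_devF x N hi⟩
    · intro r m hm
      rw [algebraMap_smul]
      exact T.smul_mem r hm
    · intro a b _ _ ha hb m hm
      rw [add_smul]
      exact T.add_mem (ha m hm) (hb m hm)
    · intro a b _ _ ha hb m hm
      rw [mul_smul]
      exact ha _ (hb m hm)
  let T' : Submodule A M :=
    { carrier := T
      add_mem' := fun ha hb => T.add_mem ha hb
      zero_mem' := T.zero_mem
      smul_mem' := fun a m hm => hstab a m hm }
  have hle : (⊤ : Submodule A M) ≤ T' := by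
    rw [← hN, Submodule.span_le]
    intro n hn
    exact hT.mpr ⟨0, hn⟩
  exact hT.mp (hle Submodule.mem_top)

/-- **`N_i = {n ∈ N | x^{i+1} n ∈ F_i}`** (GW Lemma 10.82, (10.22.2)), as a submodule of `M`.
[cite: GortzWedhorn2020, Lemma 10.82 (10.22.2)] -/
noncomputable def devN (i : ℕ) : Submodule B M := N ⊓ (devF x N i).comap (mulX x ^ (i + 1))

/-- `N_i ⊆ N`. [folklore] -/
theorem devN_le (i : ℕ) : devN x N i ≤ N := inf_le_left

/-- Membership in `N_i`. [folklore] -/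
theorem mem_devN {i : ℕ} {n : M} : n ∈ devN x N i ↔ n ∈ N ∧ x ^ (i + 1) • n ∈ devF x N i := by
  simp [devN, mulX_pow_apply]

/-- The `N_i` increase. [folklore] -/
theorem devN_monotone : Monotone (devN x N) :=
  monotone_nat_of_le_succ fun i n hn => by
    rw [mem_devN] at hn ⊢
    refine ⟨hn.1, ?_⟩
    rw [pow_succ', mul_smul]
    exact mulX_mem_devF x N hn.2

/-- **The `N_i` stabilise** when `N` is finitely generated over the Noetherian ring `B`.
[cite: GortzWedhorn2020, Lemma 10.82] -/
theorem exists_devN_eq [IsNoetherianRing B] (hNfg : N.FG) :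
    ∃ j, ∀ i, j ≤ i → devN x N i = devN x N j := by
  haveI : IsNoetherian B ↥N := isNoetherian_of_fg_of_noetherian N hNfg
  let g : ℕ →o Submodule B ↥N :=
    ⟨fun i => (devN x N i).comap N.subtype, fun i j hij => Submodule.comap_mono (devN_monotone x N hij)⟩
  obtain ⟨j, hj⟩ := monotone_stabilizes_iff_noetherian.mpr ‹_› g
  refine ⟨j, fun i hi => ?_⟩
  have h := hj i hi
  have key : ∀ k, devN x N k = ((devN x N k).comap N.subtype).map N.subtype := fun k => by
    rw [Submodule.map_comap_subtype, inf_eq_right.mpr (devN_le x N k)]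
  rw [key i, key j]
  exact congrArg (Submodule.map N.subtype) h.symm

/-- **The subquotients `F_{i+1}/F_i ≅ N/N_i`** (`n ↦ x^{i+1} n`).
[cite: GortzWedhorn2020, Lemma 10.82] -/
theorem nonempty_subquotient_equiv (i : ℕ) :
    Nonempty ((↥N ⧸ (devN x N i).comap N.subtype) ≃ₗ[B]
      (↥(devF x N (i + 1)) ⧸ (devF x N i).submoduleOf (devF x N (i + 1)))) := by
  -- the map `n ↦ [x^{i+1} n]`
  have hmem : ∀ n : ↥N, (mulX (B := B) x ^ (i + 1)) (n : M) ∈ devF x N (i + 1) := fun n =>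
    map_pow_le_devF x N (i + 1) ⟨n, n.2, rfl⟩
  let ψ : ↥N →ₗ[B] ↥(devF x N (i + 1)) :=
    LinearMap.codRestrict (devF x N (i + 1)) ((mulX x ^ (i + 1)) ∘ₗ N.subtype) hmem
  let φ : ↥N →ₗ[B] (↥(devF x N (i + 1)) ⧸ (devF x N i).submoduleOf (devF x N (i + 1))) :=
    ((devF x N i).submoduleOf (devF x N (i + 1))).mkQ ∘ₗ ψ
  have hφ : ∀ n : ↥N, φ n = Submodule.Quotient.mk (ψ n) := fun n => rfl
  have hψ : ∀ n : ↥N, (ψ n : M) = x ^ (i + 1) • (n : M) := fun n => mulX_pow_apply x (i + 1) (n : M)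
  -- surjective
  have hsurj : Function.Surjective φ := by
    intro q
    obtain ⟨⟨y, hy⟩, rfl⟩ := Submodule.mkQ_surjective _ q
    have hy' := hy
    rw [devF_succ, Submodule.mem_sup] at hy'
    obtain ⟨f, hf, z, ⟨n, hn, rfl⟩, hfz⟩ := hy'
    refine ⟨⟨n, hn⟩, ?_⟩
    rw [hφ, Submodule.mkQ_apply, Submodule.Quotient.eq, Submodule.submoduleOf, Submodule.mem_comap,
      Submodule.subtype_apply, AddSubgroupClass.coe_sub, hψ]
    change x ^ (i + 1) • n - y ∈ devF x N i
    have : x ^ (i + 1) • n - y = -f := by rw [← hfz, mulX_pow_apply]; abel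
    rw [this]
    exact (devF x N i).neg_mem hf
  -- kernel
  have hker : LinearMap.ker φ = (devN x N i).comap N.subtype := by
    ext n
    rw [LinearMap.mem_ker, hφ, Submodule.Quotient.mk_eq_zero, Submodule.submoduleOf,
      Submodule.mem_comap, Submodule.subtype_apply, Submodule.mem_comap, Submodule.subtype_apply,
      mem_devN, hψ]
    exact ⟨fun h => ⟨n.2, h⟩, fun h => h.2⟩
  exact ⟨(Submodule.quotEquivOfEq _ _ hker.symm).trans (LinearMap.quotKerEquivOfSurjective φ hsurj)⟩

end Devissage

/-! ### Freeness passes to further localizations -/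

section Transfer

open TensorProduct

variable {R : Type*} [CommRing R] {M : Type*} [AddCommGroup M] [Module R M]

/-- **If `M_r` is free over `R_r` then `M_{rc}` is free over `R_{rc}`** (`M_{rc} = R_{rc} ⊗_{R_r} M_r`).
[folklore] -/
theorem free_localizedModule_mul (r c : R)
    [Module.Free (Localization.Away r) (LocalizedModule (Submonoid.powers r) M)] :
    Module.Free (Localization.Away (r * c)) (LocalizedModule (Submonoid.powers (r * c)) M) := by
  let A₁ := Localization.Away r
  let A₂ := Localization.Away (r * c)
  let M₁ := LocalizedModule (Submonoid.powers r) M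
  let M₂ := LocalizedModule (Submonoid.powers (r * c)) M
  letI : Algebra A₁ A₂ :=
    (IsLocalization.Away.awayToAwayRight (S := A₁) (P := A₂) r c).toAlgebra
  haveI : IsScalarTower R A₁ A₂ := IsScalarTower.of_algebraMap_eq fun a =>
    (IsLocalization.Away.awayToAwayRight_eq (S := A₁) (P := A₂) r c a).symm
  have h₁ : IsBaseChange A₁ (LocalizedModule.mkLinearMap (Submonoid.powers r) M) :=
    IsLocalizedModule.isBaseChange (Submonoid.powers r) A₁ _
  have h₂ : IsBaseChange A₂ (LocalizedModule.mkLinearMap (Submonoid.powers (r * c)) M) :=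
    IsLocalizedModule.isBaseChange (Submonoid.powers (r * c)) A₂ _
  let e : A₂ ⊗[A₁] M₁ ≃ₗ[A₂] M₂ :=
    (TensorProduct.AlgebraTensorModule.congr (LinearEquiv.refl A₂ A₂) h₁.equiv.symm).trans
      ((TensorProduct.AlgebraTensorModule.cancelBaseChange R A₁ A₂ A₂ M).trans h₂.equiv)
  exact Module.Free.of_equiv e

end Transfer

/-! ### The localized dévissage: freeness of `M_t` from freeness of the subquotients -/

section Step

variable {R : Type*} [CommRing R] {B : Type*} [CommRing B] [Algebra R B]
  {A : Type*} [CommRing A] [Algebra B A]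
  {M : Type*} [AddCommGroup M] [Module A M] [Module B M] [Module R M] [IsScalarTower B A M]
  [IsScalarTower R B M]
  (x : A) (N : Submodule B M) (t : R)

/-- The localized filtration `(F_i)_t ⊆ M_t`. [folklore] -/
noncomputable abbrev devG (i : ℕ) :
    Submodule (Localization.Away t) (LocalizedModule (Submonoid.powers t) M) :=
  ((devF x N i).restrictScalars R).localized' (Localization.Away t) (Submonoid.powers t)
    (LocalizedModule.mkLinearMap (Submonoid.powers t) M)

/-- The localized filtration increases. [folklore] -/
theorem devG_monotone : Monotone (devG x N t) := fun i j hij => by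
  intro y hy
  rw [Submodule.mem_localized'] at hy ⊢
  obtain ⟨m, hm, s, rfl⟩ := hy
  exact ⟨m, devF_monotone x N hij hm, s, rfl⟩

/-- **The subquotients of the localized filtration are localizations of the `N/N_i`.**
[folklore] -/
theorem nonempty_devG_subquotient_equiv (i : ℕ) :
    Nonempty (LocalizedModule (Submonoid.powers t) (↥N ⧸ (devN x N i).comap N.subtype)
      ≃ₗ[Localization.Away t] (↥(devG x N t (i + 1)) ⧸ (devG x N t i).submoduleOf (devG x N t (i + 1)))) := by
  obtain ⟨e⟩ := nonempty_subquotient_equiv x N i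
  let Rt := Localization.Away t
  let f := LocalizedModule.mkLinearMap (Submonoid.powers t) M
  let F' : Submodule R M := (devF x N (i + 1)).restrictScalars R
  let pR : Submodule R ↥F' := ((devF x N i).submoduleOf (devF x N (i + 1))).restrictScalars R
  -- the localization map of the subquotient
  let g₀ : ↥F' →ₗ[R] ↥(devG x N t (i + 1)) := F'.toLocalized' Rt (Submonoid.powers t) f
  let g : (↥F' ⧸ pR) →ₗ[R] (↥(devG x N t (i + 1)) ⧸ pR.localized' Rt (Submonoid.powers t) g₀) :=
    pR.toLocalizedQuotient' Rt (Submonoid.powers t) g₀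
  haveI : IsLocalizedModule (Submonoid.powers t) g := inferInstance
  -- fractions in the localized submodule are fractions in `M_t`
  have hcoe : ∀ (m : ↥F') (s : Submonoid.powers t),
      ((IsLocalizedModule.mk' g₀ m s : ↥(devG x N t (i + 1))) : LocalizedModule _ M) =
        IsLocalizedModule.mk' f (m : M) s := by
    intro m s
    symm
    rw [IsLocalizedModule.mk'_eq_iff, Submonoid.smul_def]
    have h1 := IsLocalizedModule.mk'_cancel' g₀ m s
    rw [Submonoid.smul_def] at h1
    have h2 := congrArg Subtype.val h1
    rw [Submodule.coe_smul_of_tower] at h2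
    rw [h2]
    rfl
  -- identify the localized sub-submodule
  have hsub : pR.localized' Rt (Submonoid.powers t) g₀ =
      (devG x N t i).submoduleOf (devG x N t (i + 1)) := by
    ext y
    rw [Submodule.mem_localized', Submodule.submoduleOf, Submodule.mem_comap,
      Submodule.subtype_apply, Submodule.mem_localized']
    constructor
    · rintro ⟨m, hm, s, rfl⟩
      exact ⟨(m : M), hm, s, (hcoe m s).symm⟩
    · rintro ⟨m, hm, s, hy⟩
      refine ⟨⟨m, devF_monotone x N (Nat.le_succ i) hm⟩, hm, s, ?_⟩
      apply Subtype.ext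
      rw [hcoe, hy]
  -- assemble
  let e' : (↥N ⧸ (devN x N i).comap N.subtype) →ₗ[R] (↥F' ⧸ pR) :=
    (e.restrictScalars R).toLinearMap
  let ge : (↥N ⧸ (devN x N i).comap N.subtype) →ₗ[R]
      (↥(devG x N t (i + 1)) ⧸ pR.localized' Rt (Submonoid.powers t) g₀) :=
    g ∘ₗ (e.restrictScalars R : (↥N ⧸ (devN x N i).comap N.subtype) ≃ₗ[R] (↥F' ⧸ pR)).toLinearMap
  haveI : IsLocalizedModule (Submonoid.powers t) ge :=
    IsLocalizedModule.of_linearEquiv_right (Submonoid.powers t) g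
      (e.restrictScalars R : (↥N ⧸ (devN x N i).comap N.subtype) ≃ₗ[R] (↥F' ⧸ pR))
  let iso := ((IsLocalizedModule.iso (Submonoid.powers t) ge).extendScalarsOfIsLocalization
    (Submonoid.powers t) Rt)
  exact ⟨iso.trans (Submodule.quotEquivOfEq _ _ hsub)⟩

/-- **Freeness of `M_t` from freeness of the localized subquotients** (GW, proof of
Thm. 10.83: "over this localization the filtration splits"). [cite: GortzWedhorn2020, Thm. 10.83
(proof)] -/
theorem free_localizedModule_of_devissage (hx : Algebra.adjoin B {x} = ⊤)
    (hN : span A (N : Set M) = ⊤)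
    (hfreeN : Module.Free (Localization.Away t)
      (LocalizedModule (Submonoid.powers t) ↥(N.restrictScalars R)))
    (hfreeQ : ∀ k, Module.Free (Localization.Away t)
      (LocalizedModule (Submonoid.powers t) (↥N ⧸ (devN x N k).comap N.subtype))) :
    Module.Free (Localization.Away t) (LocalizedModule (Submonoid.powers t) M) := by
  let Rt := Localization.Away t
  let Mt := LocalizedModule (Submonoid.powers t) M
  let f := LocalizedModule.mkLinearMap (Submonoid.powers t) M
  let G' : ℕ → Submodule Rt Mt := fun k => match k with
    | 0 => ⊥
    | k + 1 => devG x N t k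
  have hG'0 : G' 0 = ⊥ := rfl
  have hG's : ∀ k, G' (k + 1) = devG x N t k := fun k => rfl
  have hmono : Monotone G' := monotone_nat_of_le_succ fun k => by
    cases k with
    | zero => exact bot_le
    | succ k => rw [hG's, hG's]; exact devG_monotone x N t (Nat.le_succ k)
  have hex : ∀ m' : Mt, ∃ k, m' ∈ G' k := by
    intro m'
    induction m' using LocalizedModule.induction_on with
    | h m s =>
      obtain ⟨i, hi⟩ := exists_mem_devF x N hx hN m
      refine ⟨i + 1, ?_⟩
      rw [hG's, Submodule.mem_localized']
      exact ⟨m, hi, s, (IsLocalizedModule.mk_eq_mk' s m).symm⟩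
  have hfree : ∀ k, Module.Free Rt (↥(G' (k + 1)) ⧸ (G' k).submoduleOf (G' (k + 1))) := by
    intro k
    cases k with
    | zero =>
      -- `G'_1 / G'_0 = (N)_t`
      have hbot : (G' 0).submoduleOf (G' 1) = ⊥ := by
        rw [hG'0, Submodule.submoduleOf, Submodule.comap_bot, Submodule.ker_subtype]
      let gN : ↥(N.restrictScalars R) →ₗ[R]
          ↥((N.restrictScalars R).localized' Rt (Submonoid.powers t) f) :=
        (N.restrictScalars R).toLocalized' Rt (Submonoid.powers t) f
      let isoN := (IsLocalizedModule.iso (Submonoid.powers t) gN).extendScalarsOfIsLocalization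
        (Submonoid.powers t) Rt
      haveI : Module.Free Rt ↥(G' 1) := Module.Free.of_equiv isoN
      exact Module.Free.of_equiv (Submodule.quotEquivOfEqBot _ hbot).symm
    | succ k =>
      obtain ⟨e⟩ := nonempty_devG_subquotient_equiv x N t k
      haveI := hfreeQ k
      exact Module.Free.of_equiv e
  exact Module.free_of_filtration G' hmono hG'0 hex hfree

end Step

/-! ### The induction on the number of algebra generators (GW Thm. 10.83) -/

section Main

universe u

/-- **Generic freeness, by induction on the number of generators** (GW Thm. 10.83, proof):
for `R` a Noetherian domain, `A` an `R`-algebra generated by `n` elements and `M` a finite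
`A`-module, `M_s` is free over `R_s` for some `s ≠ 0`. The case `n = 0` is Lemma 10.81 (the
free locus of the finitely presented `R`-module `M` contains the generic point, Mathlib's
`Module.FinitePresentation.exists_free_localizedModule_powers`); the induction step is
Lemma 10.82 applied to `A' = R[x₁, …, x_{n-1}] ⊆ A = A'[x_n]` and `N = Σ A'eᵢ`.
[cite: GortzWedhorn2020, Thm. 10.83] -/
theorem genericFreeness_of_adjoin_eq_top (R : Type u) [CommRing R] [IsDomain R]
    [IsNoetherianRing R] (n : ℕ) :
    ∀ (A : Type u) [CommRing A] [Algebra R A] (gens : Fin n → A),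
      Algebra.adjoin R (Set.range gens) = ⊤ →
    ∀ (M : Type u) [AddCommGroup M] [Module A M] [Module R M] [IsScalarTower R A M],
      Module.Finite A M →
      ∃ s : R, s ≠ 0 ∧
        Module.Free (Localization.Away s) (LocalizedModule (Submonoid.powers s) M) := by
  induction n with
  | zero =>
    intro A _ _ gens hgens M _ _ _ _ hM
    -- `A` is a quotient of `R`, so `M` is a finite `R`-module
    have hbot : (⊤ : Subalgebra R A) = ⊥ := by
      rw [← hgens, Set.range_eq_empty gens, Algebra.adjoin_empty]
    haveI : Module.Finite R (⊤ : Subalgebra R A) := by rw [hbot]; infer_instance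
    haveI : Module.Finite R A :=
      Module.Finite.equiv (Subalgebra.topEquiv (R := R) (A := A)).toLinearEquiv
    haveI : Module.Finite R M := Module.Finite.trans A M
    haveI : Module.FinitePresentation R M := Module.finitePresentation_of_finite R M
    haveI : Module.Free (FractionRing R) (LocalizedModule (nonZeroDivisors R) M) :=
      Module.Free.of_divisionRing _ _
    obtain ⟨r, hr, hfree, -⟩ :=
      Module.FinitePresentation.exists_free_localizedModule_powers (nonZeroDivisors R)
        (LocalizedModule.mkLinearMap (nonZeroDivisors R) M) (FractionRing R)
    exact ⟨r, nonZeroDivisors.ne_zero hr, hfree⟩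
  | succ n ih =>
    intro A _ _ gens hgens M _ _ _ _ hM
    classical
    -- `A' = R[x₁, …, x_n] ⊆ A = A'[x]`
    let A' : Subalgebra R A := Algebra.adjoin R (Set.range (gens ∘ Fin.castSucc))
    let x : A := gens (Fin.last n)
    let gens' : Fin n → ↥A' := fun i => ⟨gens (Fin.castSucc i), Algebra.subset_adjoin ⟨i, rfl⟩⟩
    have hgens' : Algebra.adjoin R (Set.range gens') = ⊤ := by
      apply Subalgebra.map_injective (f := A'.val) Subtype.val_injective
      rw [AlgHom.map_adjoin, Algebra.map_top, Subalgebra.range_val, ← Set.range_comp]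
      rfl
    haveI : Algebra.FiniteType R ↥A' :=
      ⟨⟨Finset.univ.image gens', by rw [Finset.coe_image, Finset.coe_univ, Set.image_univ, hgens']⟩⟩
    haveI : IsNoetherianRing ↥A' := Algebra.FiniteType.isNoetherianRing R ↥A'
    have hx : Algebra.adjoin (↥A') {x} = ⊤ := by
      rw [eq_top_iff]
      intro a _
      have ha : a ∈ Algebra.adjoin R (Set.range gens) := hgens ▸ Algebra.mem_top
      have hle : Algebra.adjoin R (Set.range gens) ≤ (Algebra.adjoin (↥A') {x}).restrictScalars R := by
        rw [Algebra.adjoin_le_iff]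
        rintro _ ⟨i, rfl⟩
        rw [Subalgebra.coe_restrictScalars, SetLike.mem_coe]
        refine Fin.lastCases ?_ (fun j => ?_) i
        · exact Algebra.subset_adjoin rfl
        · exact Subalgebra.algebraMap_mem (Algebra.adjoin (↥A') {x}) (gens' j)
      exact hle ha
    -- generators of `M` over `A`, and `N = Σ A'eᵢ`
    obtain ⟨r, e, he⟩ := Module.Finite.exists_fin (R := A) (M := M)
    let N : Submodule (↥A') M := Submodule.span (↥A') (Set.range e)
    have hNfg : N.FG := Submodule.fg_span (Set.finite_range e)
    have hN : Submodule.span A (N : Set M) = ⊤ := by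
      rw [eq_top_iff, ← he]
      exact Submodule.span_mono Submodule.subset_span
    haveI : Module.Finite (↥A') ↥N := Module.Finite.iff_fg.mpr hNfg
    -- the induction hypothesis for `N` and the `N/N_k`
    obtain ⟨sN, hsN0, hsN⟩ := ih (↥A') gens' hgens' (↥N) inferInstance
    have hQ : ∀ k, ∃ s : R, s ≠ 0 ∧ Module.Free (Localization.Away s)
        (LocalizedModule (Submonoid.powers s) (↥N ⧸ (devN x N k).comap N.subtype)) := fun k =>
      ih (↥A') gens' hgens' _ inferInstance
    choose sQ hsQ0 hsQ using hQ
    obtain ⟨j, hj⟩ := exists_devN_eq x N hNfg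
    -- a common denominator
    let P : R := ∏ k ∈ Finset.range (j + 1), sQ k
    have hP0 : P ≠ 0 := Finset.prod_ne_zero_iff.mpr fun k _ => hsQ0 k
    refine ⟨sN * P, mul_ne_zero hsN0 hP0, ?_⟩
    have hfreeN : Module.Free (Localization.Away (sN * P))
        (LocalizedModule (Submonoid.powers (sN * P)) ↥(N.restrictScalars R)) := by
      haveI := hsN
      exact free_localizedModule_mul (M := ↥N) sN P
    have hfreeQ' : ∀ k, k ≤ j → Module.Free (Localization.Away (sN * P))
        (LocalizedModule (Submonoid.powers (sN * P)) (↥N ⧸ (devN x N k).comap N.subtype)) := by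
      intro k hk
      have hk' : k ∈ Finset.range (j + 1) := Finset.mem_range.mpr (Nat.lt_succ_of_le hk)
      have hs : sN * P = sQ k * (sN * ∏ l ∈ (Finset.range (j + 1)).erase k, sQ l) := by
        rw [show P = sQ k * ∏ l ∈ (Finset.range (j + 1)).erase k, sQ l from
          (Finset.mul_prod_erase _ _ hk').symm]
        ring
      rw [hs]
      haveI := hsQ k
      exact free_localizedModule_mul _ _
    have hfreeQ : ∀ k, Module.Free (Localization.Away (sN * P))
        (LocalizedModule (Submonoid.powers (sN * P)) (↥N ⧸ (devN x N k).comap N.subtype)) := by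
      intro k
      by_cases hk : k ≤ j
      · exact hfreeQ' k hk
      · rw [hj k (le_of_not_ge hk)]
        exact hfreeQ' j le_rfl
    exact free_localizedModule_of_devissage x N (sN * P) hx hN hfreeN hfreeQ

/-- **Generic freeness** (Görtz–Wedhorn I, Thm. 10.83; EGA IV₂ 6.9.2; Stacks 051R): discharge of
the named fact `GortzWedhorn2020_10_83`. [cite: GortzWedhorn2020, Thm. 10.83] -/
theorem GortzWedhorn2020_10_83_holds : GortzWedhorn2020_10_83.{u} := by
  intro R A M _ _ _ _ _ _ _ _ _ hA hM
  classical
  obtain ⟨S, hS⟩ := hA.out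
  let gens : Fin S.card → A := fun i => (S.equivFin.symm i : A)
  have hrange : Set.range gens = (S : Set A) := by
    ext a
    constructor
    · rintro ⟨i, rfl⟩
      exact (S.equivFin.symm i).2
    · intro ha
      exact ⟨S.equivFin ⟨a, ha⟩, by simp [gens]⟩
  have hgens : Algebra.adjoin R (Set.range gens) = ⊤ := by rw [hrange, hS]
  obtain ⟨s, hs0, hs⟩ := genericFreeness_of_adjoin_eq_top R S.card A gens hgens M hM
  exact ⟨s, hs0, hs⟩

end Main

end Literature.RingTheory.Flat
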